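import Summits.NavierStokesRegularity.NavierStokesRegularity.Theses.TerminalTrace
import Summits.NavierStokesRegularity.NavierStokesRegularity.Theorems.TerminalTraceTypeITraceScarL3StubLocalTypeIOfTypeIBlowup
import Summits.NavierStokesRegularity.NavierStokesRegularity.Theorems.TerminalTraceTypeITraceScarL3StubExtinctApexDOfL3Trace
import Summits.NavierStokesRegularity.NavierStokesRegularity.Theorems.TerminalTraceTypeITraceScarL3NoQuietShellExtinctApex
import Literature.Analysis.FluidPDE.LocalTypeI
import Literature.Analysis.FluidPDE.VectorCalculus
import HarnessLib

/-!
# Item `TerminalTrace.TypeITraceScarL3` (stmt-NavierStokesRegularity-18385) BY NAME from the LOUD stub ALONE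
# (line `annulus-dichotomy`, skeleton v4 sha16 3f7a14107033987a)

Seat nsreg-C26-p1 (prover), `--supports stmt-NavierStokesRegularity-18385` (helper).  The registered
composition of skeleton v4 with everything landed plugged in: Stubs 1, 2′ (`stub_localTypeI_of_typeIBlowup`
p576636, `stub_extinctApexD_of_L3trace` p583907) and the now unconditional quiet-shell exclusion
`no_quietShellExtinctApex` (Q1 p593596 + Q234 p596546).  The ONE displayed hypothesis `hLOUD` is the statement
of the last open registered stub `stub_no_loudShellExtinctApex`, verbatim: when it lands, the item follows by
`typeITraceScarL3_of_loud stub_no_loudShellExtinctApex`.  (Same shape as ns-typeII-p3 g10's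
`typeITraceScarL3_of_Qstubs`, with `hQ1`, `hQ234` discharged; the confined case needs no separate stub since
QA/LOUD split on the quiet-shell clause exhaustively.)

WHAT THIS IS NOT: not LOUD, hence NOT the item and NOT Navier–Stokes regularity — a conditional kernel record.
[folklore; Tao2021 §5; Seregin2014 §6.6; AlbrittonBarker2019 §3]
-/

noncomputable section

set_option linter.dupNamespace false

namespace Summit.NavierStokesRegularity.NavierStokesRegularity.Theorems.TypeITraceScarL3

open MeasureTheory Set Function Filter Topology TopologicalSpace Metric InnerProductSpace
open Literature.Analysis Literature.Analysis.FluidPDE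
open scoped NNReal ENNReal RealInnerProductSpace

/-- **`TypeITraceScarL3` BY NAME from the LOUD stub alone**: an `L³` ball at a backward-singular vertex of a
Type-I-in-time first singularity yields a backward-singular extinct Type-I apex (Stub 2′ over Stub 1); with the
class ratio `A₀` of `no_quietShellExtinctApex`, a quiet shell is excluded by that theorem and a loud one by
`hLOUD`. [folklore; Tao2021 §5; Seregin2014 §6.6; AlbrittonBarker2019 §3] -/
theorem typeITraceScarL3_of_loud
    (hLOUD : ∀ (M D₀ : ℝ≥0) (C A₀ : ℝ), 1 < A₀ →
      (∀ (U : ℝ → EuclideanSpace ℝ (Fin 3) → EuclideanSpace ℝ (Fin 3))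
        (P : ℝ → EuclideanSpace ℝ (Fin 3) → ℝ)
        (G : ℝ → EuclideanSpace ℝ (Fin 3) →
          EuclideanSpace ℝ (Fin 3) →L[ℝ] EuclideanSpace ℝ (Fin 3)),
        (∀ a : ℝ, 0 < a →
          IsSuitableWeakSolutionInBall a (0 : ℝ × EuclideanSpace ℝ (Fin 3)) U P) →
        (∀ a : ℝ, 0 < a →
          HasWeakSpatialGradientOn
            (parabolicCylinderOpens a (0 : ℝ × EuclideanSpace ℝ (Fin 3))) U G) →
        (∀ a : ℝ, 0 < a →
          typeIBound (parabolicCylinder a (0 : ℝ × EuclideanSpace ℝ (Fin 3))) U P G ≤ M) →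
        (∀ z₀ : ℝ × EuclideanSpace ℝ (Fin 3), z₀.1 ≤ 0 →
          ∀ r : ℝ, 0 < r → cknD r z₀ P ≤ D₀) →
        (∀ s : ℝ, s < 0 →
          ∀ᵐ y : EuclideanSpace ℝ (Fin 3), ‖U s y‖ ≤ C / Real.sqrt (-s)) →
        (∀ φ : EuclideanSpace ℝ (Fin 3) → EuclideanSpace ℝ (Fin 3),
          ContDiff ℝ (⊤ : ℕ∞) φ →
          HasCompactSupport φ → ∀ ε : ℝ, 0 < ε →
          ∃ s₀ : ℝ, s₀ < 0 ∧ ∀ᵐ s ∂(volume.restrict (Ioo s₀ 0)), |∫ y, ⟪U s y, φ y⟫| ≤ ε) →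
        (∃ δ : ℝ, 0 < δ ∧ ∃ R : ℝ, 0 < R ∧ ∃ K : ℝ,
          ∀ᵐ z ∂(volume.restrict
            (Ioo (-δ) 0 ×ˢ {y : EuclideanSpace ℝ (Fin 3) | R < ‖y‖ ∧ ‖y‖ < A₀ * R})),
              ‖U z.1 z.2‖ ≤ K) →
        ¬ IsBackwardSingularPoint U (0 : ℝ × EuclideanSpace ℝ (Fin 3))) →
      ∀ (U : ℝ → EuclideanSpace ℝ (Fin 3) → EuclideanSpace ℝ (Fin 3))
        (P : ℝ → EuclideanSpace ℝ (Fin 3) → ℝ)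
        (G : ℝ → EuclideanSpace ℝ (Fin 3) →
          EuclideanSpace ℝ (Fin 3) →L[ℝ] EuclideanSpace ℝ (Fin 3)),
        (∀ a : ℝ, 0 < a →
          IsSuitableWeakSolutionInBall a (0 : ℝ × EuclideanSpace ℝ (Fin 3)) U P) →
        (∀ a : ℝ, 0 < a →
          HasWeakSpatialGradientOn
            (parabolicCylinderOpens a (0 : ℝ × EuclideanSpace ℝ (Fin 3))) U G) →
        (∀ a : ℝ, 0 < a →
          typeIBound (parabolicCylinder a (0 : ℝ × EuclideanSpace ℝ (Fin 3))) U P G ≤ M) →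
        (∀ z₀ : ℝ × EuclideanSpace ℝ (Fin 3), z₀.1 ≤ 0 →
          ∀ r : ℝ, 0 < r → cknD r z₀ P ≤ D₀) →
        (∀ s : ℝ, s < 0 →
          ∀ᵐ y : EuclideanSpace ℝ (Fin 3), ‖U s y‖ ≤ C / Real.sqrt (-s)) →
        (∀ φ : EuclideanSpace ℝ (Fin 3) → EuclideanSpace ℝ (Fin 3),
          ContDiff ℝ (⊤ : ℕ∞) φ →
          HasCompactSupport φ → ∀ ε : ℝ, 0 < ε →
          ∃ s₀ : ℝ, s₀ < 0 ∧ ∀ᵐ s ∂(volume.restrict (Ioo s₀ 0)), |∫ y, ⟪U s y, φ y⟫| ≤ ε) →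
        (¬ ∃ δ : ℝ, 0 < δ ∧ ∃ R : ℝ, 0 < R ∧ ∃ K : ℝ,
          ∀ᵐ z ∂(volume.restrict
            (Ioo (-δ) 0 ×ˢ {y : EuclideanSpace ℝ (Fin 3) | R < ‖y‖ ∧ ‖y‖ < A₀ * R})),
              ‖U z.1 z.2‖ ≤ K) →
        ¬ IsBackwardSingularPoint U (0 : ℝ × EuclideanSpace ℝ (Fin 3))) :
    Summit.NavierStokesRegularity.NavierStokesRegularity.Theses.TerminalTrace.TypeITraceScarL3 := by
  intro ν T hν hT u p hcl hLH _hdec hTI x₀ hsing ρ hρ hmem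
  obtain ⟨U, P, G, M, D₀, C, hsw, hG, hI, hD, hrate, htop, hsingU⟩ :=
    stub_extinctApexD_of_L3trace ν T hν hT u p hcl hLH hTI x₀
      (TerminalTraceTypeITraceScarL3StubLocalTypeIOfTypeIBlowup.stub_localTypeI_of_typeIBlowup
        ν T hν hT u p hcl hLH hTI x₀)
      hsing ⟨ρ, hρ, hmem⟩
  obtain ⟨A₀, hA₀, hQA⟩ := no_quietShellExtinctApex M D₀ C
  by_cases hquiet : ∃ δ : ℝ, 0 < δ ∧ ∃ R : ℝ, 0 < R ∧ ∃ K : ℝ,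
      ∀ᵐ z ∂(volume.restrict
        (Ioo (-δ) 0 ×ˢ {y : EuclideanSpace ℝ (Fin 3) | R < ‖y‖ ∧ ‖y‖ < A₀ * R})),
          ‖U z.1 z.2‖ ≤ K
  · exact hQA U P G hsw hG hI hD hrate htop hquiet hsingU
  · exact hLOUD M D₀ C A₀ hA₀ hQA U P G hsw hG hI hD hrate htop hquiet hsingU

end Summit.NavierStokesRegularity.NavierStokesRegularity.Theorems.TypeITraceScarL3
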